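import Mathlib
import Summits.Ventures.HodgeRepro2.T5AdicCompletionMap
import Summits.Ventures.HodgeRepro2.T5AdicCompletionIntegral
import Summits.Ventures.HodgeRepro2.T5AdicCompletionConductor

/-!
# THE LOCAL EXPONENT IS THE GLOBAL RAMIFICATION INDEX: `v(alg x) = v(x)^{e(w∣v)}` on the completions, and the
chain's hypotheses `Irreducible (alg ϖ)` / `¬ Irreducible (alg ϖ)` read off Mathlib's `ramificationIdx'`
(T5RamificationIndexGlobal)

Row 75 (T5AdicCompletionIntegral) gives SOME exponent `e > 0` with `v(alg x) = v(x)^e` for every `x ∈ K_v`. Mathlib's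
`IsDedekindDomain.HeightOneSpectrum.valuation_liesOver` (`v(x)^{e(w∣v)} = w(alg x)` on `K`, `e(w∣v) :=
v.asIdeal.ramificationIdx' w.asIdeal` the GLOBAL ramification index) evaluated at a global uniformiser identifies
`e = e(w∣v)`. Consequences, for a uniformiser `ϖ` of `O_{K_v}`: `Irreducible (alg ϖ) ↔ e(w∣v) = 1` (the INERT / unramified
hypothesis of the inert files and of t6-p8's `N5Local_main_inert_completion`) and, for a quadratic `L/K`,
`¬ Irreducible (alg ϖ) ↔ e(w∣v) = 2` (the RAMIFIED hypothesis `hram` of rows 165–177): the chain's case split IS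
Mathlib's global ramification index — the dictionary the referees' faithfulness check (README §10.5(i)) needs for the
words «inert / ramified place» of the print.

No axiom beyond the standard trio; nothing of the scored record changes.
§8(d): uses an L-value-free non-vanishing device: NO.
-/

namespace Summit.Ventures.HodgeRepro2.T5RamificationIndexGlobal

open IsDedekindDomain HeightOneSpectrum NumberField

variable {K : Type*} [Field K] [NumberField K] (v : HeightOneSpectrum (NumberField.RingOfIntegers K))
  {L : Type*} [Field L] [NumberField L] [Algebra K L] (w : HeightOneSpectrum (NumberField.RingOfIntegers L))
  [w.asIdeal.LiesOver v.asIdeal]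

/-- `alg (k : K_v) = (alg_{K→L} k : L_w)` for `k ∈ K` (the scalar tower `K → K_v → L_w` against `K → L → L_w`). -/
theorem algebraMap_algebraMap (k : K) :
    algebraMap (v.adicCompletion K) (w.adicCompletion L) (algebraMap K (v.adicCompletion K) k) =
      algebraMap L (w.adicCompletion L) (algebraMap K L k) := by
  rw [← IsScalarTower.algebraMap_apply, IsScalarTower.algebraMap_apply K L (w.adicCompletion L)]

/-- The valuation of `alg k` in `L_w` for `k ∈ K`: `v(k)^{e(w∣v)}` (Mathlib's `valuation_liesOver`). -/
theorem val_algebraMap_algebraMap (k : K) :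
    Valued.v (algebraMap (v.adicCompletion K) (w.adicCompletion L) (algebraMap K (v.adicCompletion K) k)) =
      Valued.v (algebraMap K (v.adicCompletion K) k) ^ (v.asIdeal.ramificationIdx' w.asIdeal) := by
  rw [algebraMap_algebraMap, Summit.Ventures.HodgeRepro2.T5AdicCompletionMap.algebraMap_L_eq_coe,
    Summit.Ventures.HodgeRepro2.T5AdicCompletionMap.algebraMap_L_eq_coe,
    IsDedekindDomain.HeightOneSpectrum.valuedAdicCompletion_eq_valuation',
    IsDedekindDomain.HeightOneSpectrum.valuedAdicCompletion_eq_valuation',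
    ← IsDedekindDomain.HeightOneSpectrum.valuation_liesOver L v w k]

/-- THE EXPONENT OF ROW 75 IS THE GLOBAL RAMIFICATION INDEX: `v(alg x) = v(x)^{e(w∣v)}` for every `x ∈ K_v`. -/
theorem val_algebraMap_eq_pow_ramificationIdx (x : v.adicCompletion K) :
    Valued.v (algebraMap (v.adicCompletion K) (w.adicCompletion L) x) =
      Valued.v x ^ (v.asIdeal.ramificationIdx' w.asIdeal) := by
  obtain ⟨e, he, hval⟩ := Summit.Ventures.HodgeRepro2.T5AdicCompletionIntegral.exists_val_algebraMap_eq_pow v w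
  -- evaluate both exponents at a global uniformiser of `v`
  obtain ⟨ϖ₀, hϖ₀⟩ := IsDedekindDomain.HeightOneSpectrum.intValuation_exists_uniformizer v
  set k : K := algebraMap (NumberField.RingOfIntegers K) K ϖ₀ with hk
  have hkv : Valued.v (algebraMap K (v.adicCompletion K) k) = WithZero.exp (-1) := by
    rw [Summit.Ventures.HodgeRepro2.T5AdicCompletionMap.algebraMap_L_eq_coe,
      IsDedekindDomain.HeightOneSpectrum.valuedAdicCompletion_eq_valuation', hk,
      IsDedekindDomain.HeightOneSpectrum.valuation_of_algebraMap, hϖ₀]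
  have h1 := val_algebraMap_algebraMap v w k
  rw [hval, hkv, ← WithZero.exp_nsmul, ← WithZero.exp_nsmul, WithZero.exp_inj] at h1
  have hee : e = v.asIdeal.ramificationIdx' w.asIdeal := by
    simp only [nsmul_eq_mul] at h1
    omega
  rw [hval, hee]

/-- `Irreducible (alg ϖ) ↔ e(w∣v) = 1`: the INERT / unramified hypothesis of the chain is the global ramification index
being `1`. -/
theorem irreducible_algebraMap_iff {ϖ : v.adicCompletionIntegers K} (hϖ : Irreducible ϖ) :
    Irreducible (algebraMap (v.adicCompletionIntegers K) (w.adicCompletionIntegers L) ϖ) ↔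
      v.asIdeal.ramificationIdx' w.asIdeal = 1 := by
  have hv : Valued.v ((algebraMap (v.adicCompletionIntegers K) (w.adicCompletionIntegers L) ϖ :
      w.adicCompletionIntegers L) : w.adicCompletion L) = WithZero.exp (-1) ^ (v.asIdeal.ramificationIdx' w.asIdeal) := by
    rw [← (Summit.Ventures.HodgeRepro2.T5AdicCompletionConductor.irreducible_iff_val_eq_exp_neg_one v ϖ).mp hϖ]
    exact val_algebraMap_eq_pow_ramificationIdx v w (ϖ : v.adicCompletion K)
  rw [Summit.Ventures.HodgeRepro2.T5AdicCompletionConductor.irreducible_iff_val_eq_exp_neg_one w, hv,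
    ← WithZero.exp_nsmul, WithZero.exp_inj]
  constructor
  · intro h
    simp only [nsmul_eq_mul] at h
    omega
  · intro h
    rw [h, one_nsmul]

/-- `e(w∣v) ≤ [L : K]` (Mathlib's `ramificationIdx_le_finrank`). -/
theorem ramificationIdx'_le_finrank : v.asIdeal.ramificationIdx' w.asIdeal ≤ Module.finrank K L := by
  haveI : NoZeroSMulDivisors (NumberField.RingOfIntegers K) (NumberField.RingOfIntegers L) := ⟨fun {c x} h => by
    rw [Algebra.smul_def] at h
    rcases mul_eq_zero.mp h with h | h
    · exact Or.inl ((map_eq_zero_iff _ (FaithfulSMul.algebraMap_injective _ _)).mp h)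
    · exact Or.inr h⟩
  exact Ideal.ramificationIdx_le_finrank (NumberField.RingOfIntegers L) K L w.asIdeal

omit [NumberField K] in
/-- `e(w∣v) ≠ 0`. -/
theorem ramificationIdx'_ne_zero : v.asIdeal.ramificationIdx' w.asIdeal ≠ 0 :=
  Ideal.IsDedekindDomain.ramificationIdx'_ne_zero_of_liesOver w.asIdeal v.ne_bot

/-- FOR A QUADRATIC `L/K`: `¬ Irreducible (alg ϖ) ↔ e(w∣v) = 2` — the RAMIFIED hypothesis `hram` of rows 165–177 is the
global ramification index being `2`. -/
theorem not_irreducible_algebraMap_iff (hKL : Module.finrank K L = 2) {ϖ : v.adicCompletionIntegers K}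
    (hϖ : Irreducible ϖ) :
    ¬ Irreducible (algebraMap (v.adicCompletionIntegers K) (w.adicCompletionIntegers L) ϖ) ↔
      v.asIdeal.ramificationIdx' w.asIdeal = 2 := by
  rw [irreducible_algebraMap_iff v w hϖ]
  have h1 := ramificationIdx'_le_finrank v w
  have h2 := ramificationIdx'_ne_zero v w
  rw [hKL] at h1
  omega

end Summit.Ventures.HodgeRepro2.T5RamificationIndexGlobal
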